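import Summits.AtomisticToContinuum.HydrodynamicLimit.Theorems.CorrectorPressureDecay.Negative.FastSectorSandwichFrame
import Summits.AtomisticToContinuum.HydrodynamicLimit.Theorems.AntiMazurCoboundariesCorrectorPressureDecayGibbsDuality
import Summits.AtomisticToContinuum.HydrodynamicLimit.Theorems.AntiMazurCoboundariesCorrectorPressureDecayEntropyBudget
import Summits.AtomisticToContinuum.HydrodynamicLimit.Theorems.AntiMazurCoboundariesCorrectorPressureDecayHellingerSplit
import Summits.AtomisticToContinuum.HydrodynamicLimit.Theorems.AntiMazurCoboundariesCorrectorPressureDecayCollisionTransport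
import Summits.AtomisticToContinuum.HydrodynamicLimit.Theorems.AntiMazurCoboundariesCorrectorPressureDecayDiscreteFejer

/-!
# `CorrectorPressureDecay`: the positive transfers of line `kinetic-entropy-collision-budget`

Route `AntiMazurCoboundaries` of `AtomisticToContinuum/HydrodynamicLimit`, crux stmt-AtomisticToContinuum-14135
(`CorrectorPressureDecay`, "X"), line `kinetic-entropy-collision-budget` (lead c1). Helper file (`--supports`): nothing
here closes the crux; these are the SUFFICIENT statements the line and the refuters isolated, transferred to X BY NAME.

* `correctorPressureDecay_of_fastSectorDominance : FastSectorDominance → CorrectorPressureDecay` — the line's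
  composition (`Cruxes/CorrectorPressureDecay/Lines/kinetic_entropy_collision_budget.lean`,
  `correctorPressureDecay_of_parts` + `pressure_arith`) run on the five LANDED stubs
  (`KineticEntropyCollisionBudget.stub_gibbsOneBodyDuality / stub_oneBodyEntropyBudget / stub_hellingerBiasSplit /
  stub_collisionTransportIdentity / stub_discreteFejerCorrector`) and stated over the tree's verbatim copies of the
  line's objects (`CorrectorPressureDecayNegative.FastSectorSandwich.*`, file `Negative/FastSectorSandwichFrame.lean`,
  planner's quantifier order `∀η ∃H₁ ∀H ∃N₀`).
* `correctorPressureDecay_of_fastSectorDominanceRate : FastSectorDominanceRate → CorrectorPressureDecay` — the transfer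
  of the promoted RATE stub (`∃H₁ ∀H ∀η ∃N₀`), through `fastSectorDominance_of_rate`.
* `correctorPressureDecay_of_discreteWindowPressureDecay : DiscreteWindowPressureDecay → CorrectorPressureDecay` —
  quantifier plumbing around the landed discrete Fejér corrector (adapted from the refuters' candidate `TestD.lean`,
  drefute g3).

The converse directions (X ⇒ each of them) are the refuters' landed theorems in
`Negative/DiscreteWindowOfCorrector.lean` / `Negative/DiscreteWindowOfKineticFlux.lean`; the `iff`s are assembled in
`AntiMazurCoboundariesCorrectorPressureDecayEquivalences.lean`.

References: Kipnis–Landim, *Scaling Limits of Interacting Particle Systems* (1999), Ch. 7 (corrector device; App. 1 §8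
entropy variational formula); Olla–Varadhan–Yau, CMP 155 (1993) §3.
-/

noncomputable section

open MeasureTheory ProbabilityTheory InformationTheory Set Filter Topology
open scoped ENNReal

namespace Summit.AtomisticToContinuum.HydrodynamicLimit.Theorems.CorrectorPressureDecayTransfer

open Literature.MathematicalPhysics.KineticTheory (T3 V3 hsDiameter localGibbsLaw)
open Literature.Analysis.FluidPDE (HardSphereFlow Config)
open Summit.AtomisticToContinuum.HydrodynamicLimit.Theses.AntiMazurCoboundaries (CorrectorPressureDecay)
open Summit.AtomisticToContinuum.HydrodynamicLimit.Theorems.CorrectorPressureDecayNegative.FastSectorSandwich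
open Summit.AtomisticToContinuum.HydrodynamicLimit.Theorems.KineticEntropyCollisionBudget
  (stub_gibbsOneBodyDuality stub_oneBodyEntropyBudget stub_hellingerBiasSplit stub_collisionTransportIdentity
    stub_discreteFejerCorrector)

/-! ## Arithmetic of the composition -/

set_option maxHeartbeats 1000000 in
/-- **The κ-clause arithmetic** of the line: from the one-body bias split `E ≤ 2M(2κ√f + κc)`, the budget `M c ≤ K`,
the dominance `M f ≤ C K/H + A K²/M + η M`, the amplitude clauses `κ ≤ 1/4`, `16κ√A ≤ 1`, the window `32κ²C ≤ δH` and
the slack `64κ²η ≤ δ²`, conclude `E − K ≤ δ M`. -/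
theorem pressure_arith {M K f c κ A C H η δ E : ℝ} (hM : 0 < M) (hK : 0 ≤ K) (hf : 0 ≤ f) (_hc : 0 ≤ c)
    (hκ : 0 < κ) (hκ4 : κ ≤ 1 / 4) (hA : 0 ≤ A) (hκA : 16 * κ * Real.sqrt A ≤ 1) (hC : 0 ≤ C) (hH : 0 < H)
    (hHC : 32 * κ ^ 2 * C ≤ δ * H) (hη : 0 ≤ η) (hηδ : 64 * κ ^ 2 * η ≤ δ ^ 2) (hδ : 0 < δ)
    (hbudget : M * c ≤ K) (hdom : M * f ≤ C * K / H + A * K ^ 2 / M + η * M)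
    (hE : E ≤ 2 * M * (2 * κ * Real.sqrt f + κ * c)) :
    E - K ≤ δ * M := by
  have hM' : M ≠ 0 := hM.ne'
  have hH' : H ≠ 0 := hH.ne'
  -- subadditivity of `√` on three nonnegative terms
  have sqrt_add_three_le : ∀ {x y z : ℝ}, 0 ≤ x → 0 ≤ y → 0 ≤ z →
      Real.sqrt (x + y + z) ≤ Real.sqrt x + Real.sqrt y + Real.sqrt z := by
    intro x y z hx hy hz
    have hsx := Real.sqrt_nonneg x
    have hsy := Real.sqrt_nonneg y
    have hsz := Real.sqrt_nonneg z
    have hxyz : 0 ≤ x + y + z := by positivity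
    refine le_of_sq_le_sq ?_ (by positivity)
    rw [Real.sq_sqrt hxyz]
    nlinarith [Real.sq_sqrt hx, Real.sq_sqrt hy, Real.sq_sqrt hz, mul_nonneg hsx hsy, mul_nonneg hsx hsz,
      mul_nonneg hsy hsz]
  have hX : 0 ≤ M * C * K / H := by positivity
  have hY : 0 ≤ A * K ^ 2 := by positivity
  have hZ : 0 ≤ η * M ^ 2 := by positivity
  have hMf : M * (M * f) ≤ M * C * K / H + A * K ^ 2 + η * M ^ 2 := by
    have h1 : M * (C * K / H + A * K ^ 2 / M + η * M) = M * C * K / H + A * K ^ 2 + η * M ^ 2 := by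
      field_simp
    calc M * (M * f) ≤ M * (C * K / H + A * K ^ 2 / M + η * M) :=
          mul_le_mul_of_nonneg_left hdom hM.le
      _ = M * C * K / H + A * K ^ 2 + η * M ^ 2 := h1
  have hsqf : M * Real.sqrt f ≤
      Real.sqrt (M * C * K / H) + Real.sqrt (A * K ^ 2) + Real.sqrt (η * M ^ 2) := by
    have hsum : 0 ≤ M * C * K / H + A * K ^ 2 + η * M ^ 2 := by positivity
    have h1 : M * Real.sqrt f ≤ Real.sqrt (M * C * K / H + A * K ^ 2 + η * M ^ 2) := by
      refine le_of_sq_le_sq ?_ (Real.sqrt_nonneg _)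
      rw [Real.sq_sqrt hsum, mul_pow, Real.sq_sqrt hf]
      have h2 : M ^ 2 * f = M * (M * f) := by ring
      rw [h2]
      exact hMf
    exact h1.trans (sqrt_add_three_le hX hY hZ)
  have hYs : Real.sqrt (A * K ^ 2) = Real.sqrt A * K := by
    rw [Real.sqrt_mul hA, Real.sqrt_sq hK]
  have hYb : 4 * κ * Real.sqrt (A * K ^ 2) ≤ K / 4 := by
    rw [hYs]
    have h3 : 4 * κ * (Real.sqrt A * K) = (16 * κ * Real.sqrt A) * K / 4 := by ring
    rw [h3]
    have h2 : (16 * κ * Real.sqrt A) * K ≤ 1 * K := mul_le_mul_of_nonneg_right hκA hK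
    linarith
  have hZs : Real.sqrt (η * M ^ 2) = Real.sqrt η * M := by
    rw [Real.sqrt_mul hη, Real.sqrt_sq hM.le]
  have h8 : 8 * κ * Real.sqrt η ≤ δ := by
    refine le_of_sq_le_sq ?_ hδ.le
    rw [mul_pow, mul_pow, Real.sq_sqrt hη]
    nlinarith [hηδ]
  have hZb : 4 * κ * Real.sqrt (η * M ^ 2) ≤ δ * M / 2 := by
    rw [hZs]
    have h3 : 4 * κ * (Real.sqrt η * M) = (8 * κ * Real.sqrt η) * M / 2 := by ring
    rw [h3]
    have h2 : (8 * κ * Real.sqrt η) * M ≤ δ * M := mul_le_mul_of_nonneg_right h8 hM.le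
    linarith
  have hXb : 4 * κ * Real.sqrt (M * C * K / H) ≤ K / 4 + 16 * κ ^ 2 * M * C / H := by
    have hq : 0 ≤ 16 * κ ^ 2 * M * C / H := by positivity
    refine le_of_sq_le_sq ?_ (by positivity)
    have hsq : (4 * κ * Real.sqrt (M * C * K / H)) ^ 2 = 4 * (K / 4) * (16 * κ ^ 2 * M * C / H) := by
      rw [mul_pow, Real.sq_sqrt hX]
      ring
    rw [hsq]
    nlinarith [sq_nonneg (K / 4 - 16 * κ ^ 2 * M * C / H)]
  have hW : 16 * κ ^ 2 * M * C / H ≤ δ * M / 2 := by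
    rw [div_le_iff₀ hH]
    have h2 : (32 * κ ^ 2 * C) * M ≤ (δ * H) * M := mul_le_mul_of_nonneg_right hHC hM.le
    linarith [h2]
  have hcb : 2 * M * (κ * c) ≤ K / 2 := by
    have h2 : κ * (M * c) ≤ κ * K := mul_le_mul_of_nonneg_left hbudget hκ.le
    linarith [h2, hκ4, hK, mul_nonneg (sub_nonneg.2 hκ4) hK]
  have hmain : 2 * M * (2 * κ * Real.sqrt f) ≤ K / 4 + 16 * κ ^ 2 * M * C / H + K / 4 + δ * M / 2 := by
    have h2 : 2 * M * (2 * κ * Real.sqrt f) = 4 * κ * (M * Real.sqrt f) := by ring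
    rw [h2]
    have h3 : 4 * κ * (M * Real.sqrt f) ≤ 4 * κ * (Real.sqrt (M * C * K / H) + Real.sqrt (A * K ^ 2) +
        Real.sqrt (η * M ^ 2)) :=
      mul_le_mul_of_nonneg_left hsqf (by positivity)
    linarith [h3, hXb, hYb, hZb]
  have hE' : E ≤ 2 * M * (2 * κ * Real.sqrt f) + 2 * M * (κ * c) := by linarith [hE]
  linarith [hE', hmain, hcb, hW]

/-! ## The line's composition on the landed stubs: `FastSectorDominance → CorrectorPressureDecay` -/

set_option maxHeartbeats 1000000 in
/-- **Fast-sector dominance implies the crux** (the composition of line `kinetic-entropy-collision-budget` with its five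
landed stubs plugged in). Choices, in the crux's quantifier order: `σ₀ := min σ₅ ½`; `κ := min κ₁ (16(√A+1))⁻¹`; given
`φ, g, δ`: `η := δ²/(64(κ²+1))`, `H := max H₁ (32κ²C/δ + 1)`, `τ₀ := 4κH/δ + 1`, `N₀` from the dominance; given
`N ≥ N₀`, `Φ`: the dominance's `n`, `lag := Hℓ_N/n`, the optimiser `Q`; then budget (stub 2) + split (stub 3) + dominance
+ `pressure_arith` give `E_Q[2A] − KL(Q‖G_N) ≤ δ(N+1)`, Gibbs duality (stub 1) the discrete-window moment bound, and the
discrete Fejér corrector (stub 6) both clauses of the crux. -/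
theorem correctorPressureDecay_of_fastSectorDominance (h₅ : FastSectorDominance) : CorrectorPressureDecay := by
  intro a θ u₀ ha hθ
  have h₄ : CollisionTransportIdentity := fun σ a θ u₀ hσ hσ2 ha hθ N Φ P hP hPG T hT hint i ψ =>
    stub_collisionTransportIdentity σ a θ u₀ hσ hσ2 ha hθ N Φ P hP hPG T hT hint i ψ
  obtain ⟨σ₅, hσ₅, H₅⟩ := h₅ h₄ a θ u₀ ha hθ
  refine ⟨min σ₅ (1 / 2), lt_min hσ₅ (by norm_num), fun σ hσ hσlt => ?_⟩
  have hσ₅' : σ < σ₅ := lt_of_lt_of_le hσlt (min_le_left _ _)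
  have hσhalf : σ ≤ 1 / 2 := (lt_of_lt_of_le hσlt (min_le_right _ _)).le
  have hP : ∀ (N : ℕ) (Φ : Flow σ N), IsProbabilityMeasure (gibbs σ a θ u₀ N Φ) := fun N Φ =>
    Literature.MathematicalPhysics.KineticTheory.isProbabilityMeasure_localGibbsLaw
      continuous_const continuous_const continuous_const (fun _ => ha) (fun _ => hθ) hσhalf N Φ
  refine ⟨hP, ?_⟩
  obtain ⟨κ₁, hκ₁, A, hA, C, hC, Hφ⟩ := H₅ σ hσ hσ₅'
  -- the amplitude clause
  set κ : ℝ := min κ₁ (16 * (Real.sqrt A + 1))⁻¹ with hκdef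
  have h16 : 0 < 16 * (Real.sqrt A + 1) := by positivity
  have hκpos : 0 < κ := lt_min hκ₁ (inv_pos.2 h16)
  have hκκ₁ : κ ≤ κ₁ := min_le_left _ _
  have hκinv : κ ≤ (16 * (Real.sqrt A + 1))⁻¹ := min_le_right _ _
  have hκ16 : 16 * κ * (Real.sqrt A + 1) ≤ 1 := by
    have h1 : κ * (16 * (Real.sqrt A + 1)) ≤ (16 * (Real.sqrt A + 1))⁻¹ * (16 * (Real.sqrt A + 1)) :=
      mul_le_mul_of_nonneg_right hκinv h16.le
    rw [inv_mul_cancel₀ h16.ne'] at h1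
    linarith
  have hκsA : 0 ≤ κ * Real.sqrt A := mul_nonneg hκpos.le (Real.sqrt_nonneg A)
  have hκA : 16 * κ * Real.sqrt A ≤ 1 := by linarith [hκ16, hκpos.le, hκsA]
  have hκ4 : κ ≤ 1 / 4 := by linarith [hκ16, hκpos.le, hκsA]
  refine ⟨κ, hκpos, fun φ g hφ hg hφ1 hgκ horth δ hδ => ?_⟩
  have hgκ₁ : ∀ v, |g v| ≤ κ₁ := fun v => (hgκ v).trans hκκ₁
  -- the slack `η` (chosen first: the planner's quantifier order) and the window `H`
  set η : ℝ := δ ^ 2 / (64 * (κ ^ 2 + 1)) with hηdef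
  have hηpos : 0 < η := by rw [hηdef]; positivity
  have h64 : (64 * (κ ^ 2 + 1) : ℝ) ≠ 0 := by positivity
  have hηδ : 64 * κ ^ 2 * η ≤ δ ^ 2 := by
    have h1 : η * (64 * (κ ^ 2 + 1)) = δ ^ 2 := by
      rw [hηdef]; exact div_mul_cancel₀ _ h64
    have h2 : 0 ≤ κ ^ 2 * η := mul_nonneg (sq_nonneg κ) hηpos.le
    linarith [h1, hηpos.le, h2]
  obtain ⟨H₁, hH₁, HH⟩ := Hφ φ g hφ hg hφ1 hgκ₁ horth η hηpos
  set H : ℝ := max H₁ (32 * κ ^ 2 * C / δ + 1) with hHdef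
  have hHH₁ : H₁ ≤ H := le_max_left _ _
  have hHpos : 0 < H := lt_of_lt_of_le hH₁ hHH₁
  have hHC : 32 * κ ^ 2 * C ≤ δ * H := by
    have h1 : 32 * κ ^ 2 * C / δ + 1 ≤ H := le_max_right _ _
    have h2 : 32 * κ ^ 2 * C / δ * δ = 32 * κ ^ 2 * C := div_mul_cancel₀ _ hδ.ne'
    have h3 : (32 * κ ^ 2 * C / δ + 1) * δ ≤ H * δ := mul_le_mul_of_nonneg_right h1 hδ.le
    linarith [h2, h3, hδ]
  obtain ⟨N₀, HN⟩ := HH H hHH₁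
  -- the cost scale `τ₀`
  set τ₀ : ℝ := 4 * κ * H / δ + 1 with hτ₀def
  have hτ₀pos : 0 < τ₀ := by rw [hτ₀def]; positivity
  have hτ₀H : 4 * κ * H ≤ δ * τ₀ := by
    have h2 : τ₀ * δ = 4 * κ * H + δ := by
      rw [hτ₀def, add_mul, one_mul, div_mul_cancel₀ _ hδ.ne']
    linarith [h2, hδ]
  refine ⟨τ₀, hτ₀pos, N₀, fun N hN Φ => ?_⟩
  obtain ⟨n, hn, hdom⟩ := HN N hN Φ
  -- the lag and the optimiser
  have hnpos : (0 : ℝ) < n := by exact_mod_cast hn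
  set lag : ℝ := H * scale N / n with hlagdef
  have hℓ : 0 < scale N := Real.rpow_pos_of_pos (by positivity) _
  have hlag : 0 < lag := by rw [hlagdef]; exact div_pos (mul_pos hHpos hℓ) hnpos
  have hnlag : (n : ℝ) * lag = H * scale N := by
    rw [hlagdef, mul_comm, div_mul_cancel₀ _ hnpos.ne']
  have hcost : 4 * κ * ((n : ℝ) * lag) ≤ δ * (τ₀ * scale N) := by
    rw [hnlag]
    have h1 : (4 * κ * H) * scale N ≤ (δ * τ₀) * scale N := mul_le_mul_of_nonneg_right hτ₀H hℓ.le
    linarith [h1]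
  haveI := hP N Φ
  obtain ⟨hQprob, hQac, hfin, hdual⟩ :=
    stub_gibbsOneBodyDuality σ a θ u₀ hσ hσhalf ha hθ N Φ φ g hφ hg ⟨1, hφ1⟩ ⟨κ, hgκ⟩ n lag hn
      (optimiser σ a θ u₀ N Φ φ g n lag) rfl
  haveI := hQprob
  obtain ⟨hLawprob, hbudget⟩ :=
    stub_oneBodyEntropyBudget σ a θ u₀ hσ hσhalf ha hθ N Φ n lag hn (optimiser σ a θ u₀ N Φ φ g n lag) hQprob
      (windowOneBodyLaw θ u₀ Φ (optimiser σ a θ u₀ N Φ φ g n lag) n lag) rfl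
  haveI := hLawprob
  -- abbreviations for the real numbers in play
  set Q := optimiser σ a θ u₀ N Φ φ g n lag with hQdef
  set Law := windowOneBodyLaw θ u₀ Φ Q n lag with hLawdef
  set K : ℝ := (klDiv Q (gibbs σ a θ u₀ N Φ)).toReal with hKdef
  have hK : 0 ≤ K := ENNReal.toReal_nonneg
  -- finiteness of the conditional entropy of `Π̄`
  have hone : (1 : ℝ≥0∞) ≤ ((N + 1 : ℕ) : ℝ≥0∞) := by exact_mod_cast Nat.succ_le_succ (Nat.zero_le N)
  have hcondle : condKL Law ≤ klDiv Q (gibbs σ a θ u₀ N Φ) :=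
    le_trans (le_mul_of_one_le_left bot_le hone) hbudget
  have hcondfin : condKL Law ≠ ∞ := ne_top_of_le_ne_top hfin hcondle
  -- the split
  obtain ⟨hfdfin, hsplit⟩ :=
    stub_hellingerBiasSplit Law hLawprob hcondfin φ g κ hφ.measurable hg.measurable hφ1 hgκ horth (fastDev Law) rfl
  -- real forms of budget and dominance
  set M : ℝ := (N : ℝ) + 1 with hMdef
  have hMpos : 0 < M := by rw [hMdef]; positivity
  set c : ℝ := (condKL Law).toReal with hcdef
  set f : ℝ := (fastDev Law).toReal with hfdef
  have hc : 0 ≤ c := ENNReal.toReal_nonneg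
  have hf : 0 ≤ f := ENNReal.toReal_nonneg
  have hbudgetR : M * c ≤ K := by
    have h1 := ENNReal.toReal_mono hfin hbudget
    rw [ENNReal.toReal_mul] at h1
    have h2 : (((N + 1 : ℕ) : ℝ≥0∞)).toReal = M := by
      rw [hMdef, ENNReal.toReal_natCast, Nat.cast_add, Nat.cast_one]
    rw [h2] at h1
    exact h1
  have hdomR : M * f ≤ C * K / H + A * K ^ 2 / M + η * M := hdom
  have hE : 2 * M * ∫ p, φ p.1 * g p.2 ∂Law ≤ 2 * M * (2 * κ * Real.sqrt f + κ * c) :=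
    mul_le_mul_of_nonneg_left hsplit (by positivity)
  have hfinal : 2 * M * ∫ p, φ p.1 * g p.2 ∂Law - K ≤ δ * M :=
    pressure_arith hMpos hK hf hc hκpos hκ4 hA hκA hC hHpos hHC hηpos.le hηδ hδ hbudgetR hdomR hE
  -- Gibbs duality: the discrete-window exponential moment
  have hmoment : ∫⁻ z, ENNReal.ofReal (Real.exp (2 * discAvg Φ (fluxObs θ u₀ φ g N) n lag z))
      ∂(gibbs σ a θ u₀ N Φ) ≤ ENNReal.ofReal (Real.exp (δ * (N + 1))) := by
    have h1 := hdual (δ * M) hfinal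
    rw [hMdef] at h1
    exact h1
  -- the discrete Fejér corrector: both clauses of the crux
  obtain ⟨W, hWm, hWb, hdef, hcostW⟩ :=
    stub_discreteFejerCorrector σ a θ u₀ hσ hσhalf ha hθ N Φ φ g κ hφ hg hφ1 hgκ n lag δ τ₀ hn hlag hτ₀pos
      hcost hmoment
  exact ⟨lag, hlag, W, hWm, hWb, hdef, hcostW⟩

/-- **The promoted RATE stub transfers to the crux**: `FastSectorDominanceRate → CorrectorPressureDecay` (through
`fastSectorDominance_of_rate`, pure quantifier logic, and the composition above). -/
theorem correctorPressureDecay_of_fastSectorDominanceRate (h : FastSectorDominanceRate) : CorrectorPressureDecay :=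
  correctorPressureDecay_of_fastSectorDominance (fastSectorDominance_of_rate h)

/-! ## Discrete-window pressure decay implies the crux -/

set_option maxHeartbeats 800000 in
/-- **Discrete-window pressure decay implies the crux** (quantifier plumbing around the landed stub 6; adapted from the
refuters' candidate `TestD.lean`, drefute g3): given `δ`, take `η := δ`, the window `H := H₁(φ, g, δ)`, `N₀ := N₀(H)`,
`τ₀ := 4κ₂H/δ`; for `N ≥ N₀` and a flow take `n := n₀(N, Φ)` and `lag := Hℓ_N/n`: the discrete Fejér corrector of stub 6
has both clauses of X. -/
theorem correctorPressureDecay_of_discreteWindowPressureDecay (hD : DiscreteWindowPressureDecay) :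
    CorrectorPressureDecay := by
  intro a θ u₀ ha hθ
  obtain ⟨σ₀, hσ₀, HD⟩ := hD a θ u₀ ha hθ
  refine ⟨min σ₀ (1 / 2), lt_min hσ₀ (by norm_num), fun σ hσ hσlt => ?_⟩
  have hσ₀' : σ < σ₀ := lt_of_lt_of_le hσlt (min_le_left _ _)
  have hσhalf : σ ≤ 1 / 2 := (lt_of_lt_of_le hσlt (min_le_right _ _)).le
  have hP : ∀ (N : ℕ) (Φ : Flow σ N), IsProbabilityMeasure (gibbs σ a θ u₀ N Φ) := fun N Φ =>
    Literature.MathematicalPhysics.KineticTheory.isProbabilityMeasure_localGibbsLaw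
      continuous_const continuous_const continuous_const (fun _ => ha) (fun _ => hθ) hσhalf N Φ
  refine ⟨hP, ?_⟩
  obtain ⟨κ₂, hκ₂, Hφ⟩ := HD σ hσ hσ₀'
  refine ⟨κ₂, hκ₂, fun φ g hφ hg hφ1 hgκ horth δ hδ => ?_⟩
  obtain ⟨H₁, hH₁, HH⟩ := Hφ φ g hφ hg hφ1 hgκ horth δ hδ
  obtain ⟨N₀, HN⟩ := HH H₁ le_rfl
  have hτ₀ : 0 < 4 * κ₂ * H₁ / δ := by positivity
  refine ⟨4 * κ₂ * H₁ / δ, hτ₀, N₀, fun N hN Φ => ?_⟩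
  obtain ⟨n₀, hn₀, Hn⟩ := HN N hN Φ
  have hmom := Hn n₀ le_rfl
  haveI := hP N Φ
  have hn₀pos : (0 : ℝ) < n₀ := by exact_mod_cast hn₀
  have hℓ : 0 < scale N := Real.rpow_pos_of_pos (by positivity) _
  set lag : ℝ := H₁ * scale N / n₀ with hlagdef
  have hlag : 0 < lag := div_pos (mul_pos hH₁ hℓ) hn₀pos
  have hnlag : (n₀ : ℝ) * lag = H₁ * scale N := by rw [hlagdef]; field_simp
  have hcost : 4 * κ₂ * ((n₀ : ℝ) * lag) ≤ δ * ((4 * κ₂ * H₁ / δ) * scale N) := by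
    rw [hnlag]
    refine le_of_eq ?_
    field_simp
  have hFm : Measurable (fluxObs θ u₀ φ g N) := measurable_fluxObs hφ hg N
  have hAm : Measurable fun z => 2 * discAvg Φ (fluxObs θ u₀ φ g N) n₀ lag z :=
    (measurable_discAvg Φ hFm n₀ lag).const_mul 2
  have hAb : ∀ z, |2 * discAvg Φ (fluxObs θ u₀ φ g N) n₀ lag z| ≤ 2 * ((N + 1) * κ₂) := fun z => by
    rw [abs_mul, abs_two]
    exact mul_le_mul_of_nonneg_left (abs_discAvg_le Φ (abs_fluxObs_le hφ1 hgκ N) hn₀ lag z) zero_le_two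
  have hmomL : ∫⁻ z, ENNReal.ofReal (Real.exp (2 * discAvg Φ (fluxObs θ u₀ φ g N) n₀ lag z)) ∂(gibbs σ a θ u₀ N Φ) ≤
      ENNReal.ofReal (Real.exp (δ * (N + 1))) := by
    rw [← ofReal_integral_eq_lintegral_ofReal
      (Summit.AtomisticToContinuum.HydrodynamicLimit.Theorems.CorrectorPressureDecayNegative.integrable_exp_of_abs_le
        hAm hAb)
      (ae_of_all _ fun z => (Real.exp_pos _).le)]
    exact ENNReal.ofReal_le_ofReal hmom
  obtain ⟨W, hWm, hWb, hdef, hcostW⟩ :=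
    stub_discreteFejerCorrector σ a θ u₀ hσ hσhalf ha hθ N Φ φ g κ₂ hφ hg hφ1 hgκ n₀ lag δ (4 * κ₂ * H₁ / δ) hn₀
      hlag hτ₀ hcost hmomL
  exact ⟨lag, hlag, W, hWm, hWb, hdef, hcostW⟩

/-! ## Registered forms (stubs `kecb_*` of crux stmt-AtomisticToContinuum-14135, line `kinetic-entropy-collision-budget`) -/

/-- Registered transfer `kecb_fastSectorTransfer`: `FastSectorDominance → CorrectorPressureDecay`. -/
theorem kecb_fastSectorTransfer : FastSectorDominance → CorrectorPressureDecay :=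
  correctorPressureDecay_of_fastSectorDominance

/-- Registered transfer `kecb_rateTransfer`: `FastSectorDominanceRate → CorrectorPressureDecay`. -/
theorem kecb_rateTransfer : FastSectorDominanceRate → CorrectorPressureDecay :=
  correctorPressureDecay_of_fastSectorDominanceRate

/-- Registered transfer `kecb_windowTransfer`: `DiscreteWindowPressureDecay → CorrectorPressureDecay`. -/
theorem kecb_windowTransfer : DiscreteWindowPressureDecay → CorrectorPressureDecay :=
  correctorPressureDecay_of_discreteWindowPressureDecay

end Summit.AtomisticToContinuum.HydrodynamicLimit.Theorems.CorrectorPressureDecayTransfer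

end
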